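import Summits.Ventures.DiscreteObjects.PP12.FanoFiveKernelSearch
import Summits.Ventures.DiscreteObjects.PP12.FanoFiveECodeWordsPerm
import Summits.Ventures.DiscreteObjects.PP12.FanoFiveWordCheckerSound

/-!
# PP(12), order 5: the `S₅ × S₂` action on word codes by generator words, and the parts of a word code (kernel; lemmas for the certificate)
Framing: lottery ticket; floor = certified bounds/negative ranges.

Cell pub-namedobj (venture DiscreteObjects), target (M), designs gen 18; continues `FanoFiveKernelSearch`. (1) The five generators `Kernel.gen g`
(bit exchanges `(0 1), (1 2), (2 3), (3 4), (5 6)`) are `FanoFiveECodeWordsPerm.permWord` of bit permutations fixing `{5, 6}` setwise (finite check by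
`decide`), so by `IsWordCode.perm` the image of a word code under any generator word is a word code (`isWordCode_applyGens`); generator words preserve
the weight and are injective on 7-bit words. (2) The parts of a word code: its weight-2 words `A` (four of them) and weight-4 words `C` (nine), as increasing
sublists of `Cert.W2 / Cert.W4`, make `[0, 95, 63] ++ A ++ C` pass the leaf test `Cert.FullP` (`parts_of_isWordCode`; the argument of
`FanoFiveWordCheckerSound.noWordCode_of_checked`, restated as a lemma; its `countP_eq_card_filter` is reused), and `A` is FEASIBLE — exactly one word with bit `5` and one with bit `6` — because
the two words at distance `6` from `95` (resp. `63`) are `0` and a weight-2 word containing bit `5` (resp. `6`) (`feasible_of_isWordCode`).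
Nothing is evaluated here beyond finite word facts; no census statement is discharged. No `sorry`, no new axioms.
-/

namespace Summit.Ventures.DiscreteObjects.PP12

open Finset

namespace FanoFive

namespace Kernel

open Cert

/-! ### the generators are word permutations -/

/-- finite facts about the generators (by `decide`): the bits of the image, the range, and the action on the positions `5, 6` -/
theorem gen_facts : (∀ g < 5, ∀ w < 128, ∀ x : Fin 7, (gen g w).testBit x.1 = w.testBit (genPerm g x).1) ∧ (∀ g < 5, ∀ w < 128, gen g w < 128) ∧
    (∀ g < 5, (genPerm g 5 = 5 ∧ genPerm g 6 = 6) ∨ (genPerm g 5 = 6 ∧ genPerm g 6 = 5)) :=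
  ⟨by decide +kernel, by decide +kernel, by decide⟩

/-- a generator is the word permutation of its bit permutation (on 7-bit words) -/
theorem gen_eq_permWord {g : ℕ} (hg : g < 5) {w : ℕ} (hw : w < 128) : gen g w = permWord (genPerm g) w := by
  apply Nat.eq_of_testBit_eq
  intro i
  by_cases hi : i < 7
  · rw [gen_facts.1 g hg w hw ⟨i, hi⟩, testBit_permWord (genPerm g) w ⟨i, hi⟩]
  · push Not at hi
    rw [testBit_ge_of_lt (gen_facts.2.1 g hg w hw) hi, testBit_permWord_ge _ _ hi]

/-- the image of a word code under a generator is a word code -/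
theorem isWordCode_gen {W : Finset ℕ} (hW : IsWordCode W) {g : ℕ} (hg : g < 5) : IsWordCode (W.image (gen g)) := by
  have e : W.image (gen g) = W.image (permWord (genPerm g)) :=
    Finset.image_congr fun w hw => gen_eq_permWord hg (hW.lt w (Finset.mem_coe.1 hw))
  rw [e]
  exact hW.perm (genPerm g) (gen_facts.2.2 g hg)

/-- unfolding one generator of a word -/
theorem applyGens_cons (g : ℕ) (gs : List ℕ) (w : ℕ) : applyGens (g :: gs) w = applyGens gs (gen g w) := rfl

/-- **the image of a word code under a generator word is a word code** -/
theorem isWordCode_applyGens : ∀ {gs : List ℕ}, (∀ g ∈ gs, g < 5) → ∀ {W : Finset ℕ}, IsWordCode W → IsWordCode (W.image (applyGens gs))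
  | [], _, W, hW => by
    have e : W.image (applyGens []) = W := by
      have : (applyGens [] : ℕ → ℕ) = id := funext fun w => rfl
      rw [this, Finset.image_id]
    rw [e]; exact hW
  | g :: gs, hgs, W, hW => by
    have e : W.image (applyGens (g :: gs)) = (W.image (gen g)).image (applyGens gs) := by
      rw [Finset.image_image]; rfl
    rw [e]
    exact isWordCode_applyGens (fun g' hg' => hgs g' (List.mem_cons_of_mem g hg')) (isWordCode_gen hW (hgs g List.mem_cons_self))

/-- generator words preserve the distance from the zero word and the 7-bit range -/
theorem applyGens_weight : ∀ {gs : List ℕ}, (∀ g ∈ gs, g < 5) → ∀ {w : ℕ}, w < 128 → hdist 0 (applyGens gs w) = hdist 0 w ∧ applyGens gs w < 128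
  | [], _, w, hw => ⟨rfl, hw⟩
  | g :: gs, hgs, w, hw => by
    have hg : g < 5 := hgs g List.mem_cons_self
    have hgw : gen g w < 128 := gen_facts.2.1 g hg w hw
    obtain ⟨h1, h2⟩ := applyGens_weight (gs := gs) (fun g' hg' => hgs g' (List.mem_cons_of_mem g hg')) hgw
    refine ⟨?_, h2⟩
    have e0 : hdist 0 (permWord (genPerm g) w) = hdist 0 w := by
      have := hdist_permWord (genPerm g) 0 w
      rwa [permWord_zero] at this
    rw [applyGens_cons, h1, gen_eq_permWord hg hw, e0]

/-- generator words are injective on 7-bit words -/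
theorem applyGens_inj : ∀ {gs : List ℕ}, (∀ g ∈ gs, g < 5) → ∀ {v w : ℕ}, v < 128 → w < 128 → applyGens gs v = applyGens gs w → v = w
  | [], _, v, w, _, _, h => h
  | g :: gs, hgs, v, w, hv, hw, h => by
    have hg : g < 5 := hgs g List.mem_cons_self
    rw [applyGens_cons, applyGens_cons] at h
    have h' := applyGens_inj (fun g' hg' => hgs g' (List.mem_cons_of_mem g hg')) (gen_facts.2.1 g hg v hv) (gen_facts.2.1 g hg w hw) h
    rw [gen_eq_permWord hg hv, gen_eq_permWord hg hw] at h'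
    exact permWord_inj (genPerm g) hv hw h'

/-! ### finite word facts -/

/-- the two candidate lists: no duplicates, disjoint, 7-bit, the weight classes `2` and `4` -/
theorem lists_facts2 : W2.Nodup ∧ W4.Nodup ∧ (∀ w ∈ W2, w ∉ W4) ∧ (∀ w ∈ W2, w < 128) ∧
    (∀ w < 128, (w ∈ W2 ↔ hdist 0 w = 2)) ∧ (∀ w < 128, (w ∈ W4 ↔ hdist 0 w = 4)) := by
  refine ⟨by decide, by decide, by decide, by decide, by decide, by decide⟩

/-- the fixed words `0, 95, 63` are in neither list -/
theorem fixed_facts : 0 ∉ W2 ∧ 0 ∉ W4 ∧ 95 ∉ W2 ∧ 95 ∉ W4 ∧ 63 ∉ W2 ∧ 63 ∉ W4 := by decide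

/-- the words at distance `6` from `95` (resp. `63`) are `0` and the weight-2 words containing bit `5` (resp. `6`) -/
theorem six_facts : (∀ w < 128, (hdist 95 w = 6 ↔ (w = 0 ∨ (w ∈ W2 ∧ w.testBit 5 = true)))) ∧
    (∀ w < 128, (hdist 63 w = 6 ↔ (w = 0 ∨ (w ∈ W2 ∧ w.testBit 6 = true)))) := ⟨by decide, by decide⟩

/-- the kernel-evaluable distance `Cert.hd` is the Hamming distance `hdist` on 7-bit words (by evaluation) -/
theorem hd_eq_hdist7 : ∀ v < 128, ∀ w < 128, hd v w = hdist v w := by decide +kernel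

/-! ### the parts of a word code -/

/-- **the weight-2 part `A` and the weight-4 part `C` of a word code**, as increasing sublists of `W2` and `W4`: four and nine words, and
`[0, 95, 63] ++ A ++ C` passes the leaf test `FullP` (the content of `FanoFiveWordCheckerSound.noWordCode_of_checked`, as a lemma) -/
theorem parts_of_isWordCode {W : Finset ℕ} (hW : IsWordCode W) :
    (W2.filter fun w => decide (w ∈ W)).length = 4 ∧ (W4.filter fun w => decide (w ∈ W)).length = 9 ∧
      FullP (([0, 95, 63] ++ W2.filter fun w => decide (w ∈ W)) ++ W4.filter fun w => decide (w ∈ W)) := by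
  obtain ⟨n2, n4, h24, -, hW2, hW4⟩ := lists_facts2
  obtain ⟨h0_2, h0_4, h95_2, h95_4, h63_2, h63_4⟩ := fixed_facts
  set A : List ℕ := W2.filter fun w => decide (w ∈ W) with hAdef
  set C : List ℕ := W4.filter fun w => decide (w ∈ W) with hCdef
  have hAmem : ∀ w, w ∈ A ↔ w ∈ W2 ∧ w ∈ W := fun w => by simp [hAdef]
  have hCmem : ∀ w, w ∈ C ↔ w ∈ W4 ∧ w ∈ W := fun w => by simp [hCdef]
  have hAnd : A.Nodup := n2.filter _
  have hCnd : C.Nodup := n4.filter _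
  have hAlen : A.length = 4 := by
    rw [← List.toFinset_card_of_nodup hAnd, ← hW.two 0 hW.zero_mem]
    congr 1
    ext w
    simp only [List.mem_toFinset, hAmem, Finset.mem_filter]
    constructor
    · rintro ⟨h2, hw⟩; exact ⟨hw, (hW2 w (hW.lt w hw)).1 h2⟩
    · rintro ⟨hw, hd2⟩; exact ⟨(hW2 w (hW.lt w hw)).2 hd2, hw⟩
  have hClen : C.length = 9 := by
    rw [← List.toFinset_card_of_nodup hCnd, ← hW.four 0 hW.zero_mem]
    congr 1
    ext w
    simp only [List.mem_toFinset, hCmem, Finset.mem_filter]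
    constructor
    · rintro ⟨h4, hw⟩; exact ⟨hw, (hW4 w (hW.lt w hw)).1 h4⟩
    · rintro ⟨hw, hd4⟩; exact ⟨(hW4 w (hW.lt w hw)).2 hd4, hw⟩
  refine ⟨hAlen, hClen, ?_⟩
  set L : List ℕ := ([0, 95, 63] ++ A) ++ C with hLdef
  have hLmem : ∀ w, w ∈ L → w ∈ W := by
    intro w hw
    simp only [hLdef, List.mem_append, List.mem_cons, List.mem_nil_iff, or_false] at hw
    rcases hw with ((rfl | rfl | rfl) | hA) | hC
    · exact hW.zero_mem
    · exact hW.w5_mem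
    · exact hW.w6_mem
    · exact ((hAmem w).1 hA).2
    · exact ((hCmem w).1 hC).2
  have hLnd : L.Nodup := by
    rw [hLdef, List.nodup_append]
    refine ⟨?_, hCnd, ?_⟩
    · rw [List.nodup_append]
      refine ⟨by simp, hAnd, ?_⟩
      intro w hw w' hw' e
      subst e
      simp only [List.mem_cons, List.mem_nil_iff, or_false] at hw
      have hw2 : w ∈ W2 := ((hAmem w).1 hw').1
      rcases hw with rfl | rfl | rfl
      · exact h0_2 hw2
      · exact h95_2 hw2
      · exact h63_2 hw2
    · intro w hw w' hw' e
      subst e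
      have hw4 : w ∈ W4 := ((hCmem w).1 hw').1
      simp only [List.mem_append, List.mem_cons, List.mem_nil_iff, or_false] at hw
      rcases hw with (rfl | rfl | rfl) | hA
      · exact h0_4 hw4
      · exact h95_4 hw4
      · exact h63_4 hw4
      · exact h24 w ((hAmem w).1 hA).1 hw4
  have hLlen : L.length = 16 := by simp [hLdef, hAlen, hClen]
  have hLW : L.toFinset = W := by
    apply Finset.eq_of_subset_of_card_le
    · intro w hw; exact hLmem w (List.mem_toFinset.1 hw)
    · rw [hW.card_eq, List.toFinset_card_of_nodup hLnd, hLlen]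
  have hcount : ∀ p : ℕ → Bool, L.countP p = (W.filter fun w => p w = true).card := fun p => by
    rw [countP_eq_card_filter hLnd, hLW]
  refine ⟨fun x => ?_, fun u hu => ?_, fun x y hxy => ?_⟩
  · unfold colc; rw [hcount]; exact hW.balanced x
  · have huW := hLmem u hu
    unfold cntd
    rw [hcount, hcount, hcount]
    have hu128 : u < 128 := hW.lt u huW
    have e : ∀ d : ℕ, (W.filter fun w => (hd u w == d) = true) = W.filter fun w => hdist u w = d := fun d => by
      refine Finset.filter_congr fun w hw => ?_
      rw [← hd_eq_hdist7 u hu128 w (hW.lt w hw)]; simp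
    rw [e, e, e]
    exact ⟨hW.two u huW, hW.four u huW, hW.six u huW⟩
  · unfold colpair
    rw [hcount]
    have e : (W.filter fun w => (w.testBit x != w.testBit y) = true) = W.filter fun w => w.testBit x ≠ w.testBit y := by
      ext w; simp
    rw [e]
    exact hW.corr x y hxy

/-- **the weight-2 part of a word code is feasible**: exactly one of its words has bit `5`, exactly one has bit `6` -/
theorem feasible_of_isWordCode {W : Finset ℕ} (hW : IsWordCode W) : feasible (W2.filter fun w => decide (w ∈ W)) = true := by
  obtain ⟨n2, -, -, hlt2, -, -⟩ := lists_facts2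
  set A : List ℕ := W2.filter fun w => decide (w ∈ W) with hAdef
  have hAmem : ∀ w, w ∈ A ↔ w ∈ W2 ∧ w ∈ W := fun w => by simp [hAdef]
  have hAnd : A.Nodup := n2.filter _
  -- the count of words of `A` with bit `b` is one, from the two words at distance six from `v`
  have key : ∀ (b : ℕ) (v : ℕ), v ∈ W → (∀ w < 128, (hdist v w = 6 ↔ (w = 0 ∨ (w ∈ W2 ∧ w.testBit b = true)))) →
      A.countP (fun a => a.testBit b) = 1 := by
    intro b v hv hchar
    have h6 := hW.six v hv
    have e : (W.filter fun w => hdist v w = 6) = insert 0 (A.toFinset.filter fun a => a.testBit b = true) := by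
      ext w
      simp only [Finset.mem_filter, Finset.mem_insert, List.mem_toFinset, hAmem]
      constructor
      · rintro ⟨hw, hd⟩
        rcases (hchar w (hW.lt w hw)).1 hd with h | ⟨h2, hb⟩
        · exact Or.inl h
        · exact Or.inr ⟨⟨h2, hw⟩, hb⟩
      · rintro (rfl | ⟨⟨h2, hw⟩, hb⟩)
        · exact ⟨hW.zero_mem, (hchar 0 (by norm_num)).2 (Or.inl rfl)⟩
        · exact ⟨hw, (hchar w (hlt2 w h2)).2 (Or.inr ⟨h2, hb⟩)⟩
    have h0 : (0 : ℕ) ∉ A.toFinset.filter fun a => a.testBit b = true := by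
      simp [Nat.zero_testBit]
    rw [e, Finset.card_insert_of_notMem h0] at h6
    rw [countP_eq_card_filter hAnd]
    omega
  unfold feasible
  rw [key 5 95 hW.w5_mem six_facts.1, key 6 63 hW.w6_mem six_facts.2]
  decide

end Kernel

end FanoFive

end Summit.Ventures.DiscreteObjects.PP12
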